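import Literature.NumberTheory.LFunctions.WeilBochnerExtension
import Literature.NumberTheory.LFunctions.WeilExplicitDirichletWeilForm
import Literature.NumberTheory.LFunctions.ExplicitFormulaPsiOne
import Literature.Analysis.SpecialFunctions.DigammaVerticalAsymptotics
import HarnessLib

/-!
# Kreĭn–M. Riesz extension for Weil's functional of a Dirichlet character (GRH arm)

Topic `Literature/NumberTheory/LFunctions`; the `χ`-twisted twin of `WeilBochnerExtension.lean`
(normalisation of `WeilExplicitDirichlet.lean`: `W_χ = weilFunctionalChar χ`,
`Q_χ(g) = W_χ(g ⋆ g̃) = weilQuadraticChar χ g`, rungs `WeilPositivityOnChar χ a`).  Everything here is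
PROVED; no definitions, no named facts.

* Linearity and reality of `W_χ` on test functions: `weilFunctionalChar_const_mul`,
  `weilFunctionalChar_smul_real`, `integrable_archChar_of_isWeilTest`, `weilFunctionalChar_add`,
  `conj_weilFunctionalChar` (`conj W_χ(k) = W_χ(k̃)` with no hypothesis on `k` or `χ`),
  `re_weilFunctionalChar_weilReflect`.
* `re_weilFunctionalChar_nonneg_of_factor`: hermitian symmetrisation — Weil positivity for `χ` on
  `[-a, a]` plus a Boas–Kac factorisation give `Re W_χ(k) ≥ 0` on the cone of tests supported in
  `[-R, R]` with `Re k̂(½+it) ≥ 0`.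
* **`exists_positive_extension_char`**: M. Riesz extension — if `Re W_χ ≥ 0` on that cone then there is
  a positive linear functional `Λ` on `C_c(ℝ, ℝ)` with `Re W_χ(k) + Λ c ≥ 0` whenever
  `Re k̂(½+it) + c(t) ≥ 0` for all `t` (the cofinality step `WeilBochner.exists_sq_dominating` is the
  `ζ`-file's, being a statement about transforms only).

This is the functional-analytic input for the Bochner–Kreĭn representation of the rungs of the GRH
arm (`WeilBochnerRepresentationChar.lean`): a rung `WeilPositivityOnChar χ b` is a positive-measure
moment problem on the critical line exactly as for `ζ`.

References: M. G. Kreĭn, C. R. (Doklady) Acad. Sci. URSS 26 (1940) 17–22 [cite: Krein1940];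
A. Weil, *Sur les "formules explicites" de la théorie des nombres premiers* (1952), (11) and the «lemme»
p. 262 [cite: Weil1952FormulesExplicites].
-/

noncomputable section

open Complex Filter Set MeasureTheory CompactlySupported
open scoped Real Topology ContDiff ComplexConjugate

namespace Literature.NumberTheory.LFunctions

namespace WeilBochnerChar

variable {q : ℕ} (χ : DirichletCharacter ℂ q) {k k₁ k₂ : ℝ → ℂ}

/-! ## Linearity of `W_χ` -/

/-- `W_χ(m k) = m W_χ(k)` for a constant `m` (no hypotheses; both sides carry the same junk values).
[cite: Weil1952FormulesExplicites, (11) pp. 261–262] -/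
theorem weilFunctionalChar_const_mul (m : ℂ) (k : ℝ → ℂ) :
    weilFunctionalChar χ (fun t ↦ m * k t) = m * weilFunctionalChar χ k := by
  have hP : weilPolarTerm (fun t ↦ m * k t) = m * weilPolarTerm k := by
    simp only [weilPolarTerm, weilMellin_const_mul]
    ring
  have hPr : weilPrimeTermChar χ (fun t ↦ m * k t) = m * weilPrimeTermChar χ k := by
    simp only [weilPrimeTermChar]
    rw [← tsum_mul_left]
    congr 1 with n
    ring
  have hAI : weilArchIntegralChar (charParity χ) (fun t ↦ m * k t) =
      m * weilArchIntegralChar (charParity χ) k := by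
    simp only [weilArchIntegralChar, weilMellin_const_mul]
    rw [← integral_const_mul]
    congr 1 with t
    ring
  have hA : weilArchTermChar q (charParity χ) (fun t ↦ m * k t) =
      m * weilArchTermChar q (charParity χ) k := by
    simp only [weilArchTermChar, hAI]
    ring
  simp only [weilFunctionalChar, hPr, hA]
  split_ifs
  · rw [hP]; ring
  · ring

/-- `W_χ(c k) = c W_χ(k)` for real `c`. [cite: Weil1952FormulesExplicites, (11) pp. 261–262] -/
theorem weilFunctionalChar_smul_real (c : ℝ) (k : ℝ → ℂ) :
    weilFunctionalChar χ (c • k) = (c : ℂ) * weilFunctionalChar χ k := by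
  rw [WeilBochner.smul_real_eq, weilFunctionalChar_const_mul]

/-- The shifted archimedean weight `t ↦ Re ψ(¼ + a/2 + it/2)` of Weil's (11) (the logarithmic
derivative of the gamma factor `Γ((s+a)/2)` on the critical line) is continuous and
`|Re ψ(¼ + a/2 + it/2)| ≤ C + log(1 + |t|)` (Stirling on a vertical line).
[cite: Weil1952FormulesExplicites, (4)–(5) p. 254 and (10) p. 258] -/
theorem exists_archWeightChar_bound (a : ℕ) :
    Continuous (fun t : ℝ ↦ (Complex.digamma (1 / 4 + (a : ℂ) / 2 + t / 2 * I)).re) ∧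
      ∃ C : ℝ, 0 ≤ C ∧ ∀ t : ℝ, |(Complex.digamma (1 / 4 + (a : ℂ) / 2 + t / 2 * I)).re| ≤
        C + Real.log (1 + |t|) := by
  have ha : (0 : ℝ) < 1 / 4 + (a : ℝ) / 2 := by positivity
  have hw : ∀ t : ℝ, (1 / 4 : ℂ) + (a : ℂ) / 2 + (t : ℂ) / 2 * I =
      (((1 / 4 + (a : ℝ) / 2 : ℝ)) : ℂ) + ((t / 2 : ℝ) : ℂ) * I := by
    intro t; push_cast; ring
  refine ⟨?_, ?_⟩
  · refine Complex.continuous_re.comp ?_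
    refine Literature.Analysis.SpecialFunctions.Complex.continuousOn_digamma.comp_continuous
      (by fun_prop) fun t ↦ ?_
    rw [hw t]
    simpa using ha
  · obtain ⟨C, hC⟩ :=
      Literature.Analysis.SpecialFunctions.Complex.exists_norm_digamma_sub_log_le_of_pos ha
    refine ⟨|C|, abs_nonneg C, fun t ↦ ?_⟩
    have h2 := hC (t / 2)
    rw [← hw t] at h2
    have h3 : Real.log (1 + |t / 2|) ≤ Real.log (1 + |t|) := by
      refine Real.log_le_log (by positivity) ?_
      rw [abs_div, abs_two]
      linarith [abs_nonneg t]
    have h4 : |(Complex.digamma (1 / 4 + (a : ℂ) / 2 + t / 2 * I)).re -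
        Real.log (1 + |t / 2|)| ≤ C := by
      have := Complex.abs_re_le_norm (Complex.digamma (1 / 4 + (a : ℂ) / 2 + t / 2 * I) -
        Real.log (1 + |t / 2|))
      rw [Complex.sub_re, Complex.ofReal_re] at this
      exact this.trans h2
    have hlog0 : 0 ≤ Real.log (1 + |t / 2|) := Real.log_nonneg (by linarith [abs_nonneg (t / 2)])
    rw [abs_le] at h4 ⊢
    constructor <;> linarith [h4.1, h4.2, le_abs_self C, neg_abs_le C]

/-- The archimedean integrand `k̂(½+it) Re ψ(¼ + a/2 + it/2)` of a Weil test is integrable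
(`‖k̂(½+it)‖ ≤ D/(1+t²)` and the weight is `O(log(2+|t|))`): the archimedean term of Weil's (11)
converges absolutely on the class `C_c^∞ ⊆` (A), (B).
[cite: Weil1952FormulesExplicites, (11) pp. 261–262 (archimedean term on the class (A), (B))] -/
theorem integrable_archChar_of_isWeilTest (hk : IsWeilTest k) (a : ℕ) :
    Integrable fun t : ℝ ↦ weilMellin k (1 / 2 + t * I) *
      ((Complex.digamma (1 / 4 + (a : ℂ) / 2 + t / 2 * I)).re : ℂ) := by
  obtain ⟨hcont, C, hC0, hC⟩ := exists_archWeightChar_bound a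
  set D := weilDecayConst k with hD
  have hre : ∀ u : ℝ, ((1 : ℂ) / 2 + u * I).re = 1 / 2 := fun u ↦ by simp
  have him : ∀ u : ℝ, ((1 : ℂ) / 2 + u * I).im = u := fun u ↦ by simp
  have hdec : ∀ u : ℝ, ‖weilMellin k (1 / 2 + u * I)‖ ≤ D / (1 + u ^ 2) := fun u ↦ by
    have h := norm_weilMellin_le hk (s := 1 / 2 + u * I) (by rw [hre]; norm_num) (by rw [hre]; norm_num)
    rwa [him] at h
  have hD0 : 0 ≤ D := by
    have h := (norm_nonneg _).trans (hdec 0)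
    simpa using h
  have hmeas : AEStronglyMeasurable (fun t : ℝ ↦ weilMellin k (1 / 2 + t * I) *
      ((Complex.digamma (1 / 4 + (a : ℂ) / 2 + t / 2 * I)).re : ℂ)) volume :=
    (((continuous_weilMellin hk.1.continuous hk.2).comp (by fun_prop : Continuous fun t : ℝ ↦
      (1 / 2 : ℂ) + t * I)).mul (continuous_ofReal.comp hcont)).aestronglyMeasurable
  refine ((PsiOneExplicit.integrable_left_majorant hC0).const_mul D).mono' hmeas
    (ae_of_all _ fun t ↦ ?_)
  have hlog : 0 ≤ Real.log (1 + |t|) := Real.log_nonneg (by linarith [abs_nonneg t])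
  rw [norm_mul, Complex.norm_real, Real.norm_eq_abs]
  calc ‖weilMellin k (1 / 2 + t * I)‖ * |(Complex.digamma (1 / 4 + (a : ℂ) / 2 + t / 2 * I)).re|
      ≤ D / (1 + t ^ 2) * (C + Real.log (1 + |t|)) :=
        mul_le_mul (hdec t) (hC t) (abs_nonneg _) (by positivity)
    _ ≤ D * ((C + 2 * Real.log (1 + |t|)) / (1 / 4 + t ^ 2)) := by
        rw [div_mul_eq_mul_div, mul_div_assoc]
        refine mul_le_mul_of_nonneg_left ?_ hD0
        rw [div_le_div_iff₀ (by positivity) (by positivity)]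
        nlinarith [mul_nonneg hlog (sq_nonneg t), mul_nonneg hC0 (sq_nonneg t)]

/-- **Additivity of `W_χ` on test functions**: `W_χ(k₁ + k₂) = W_χ(k₁) + W_χ(k₂)`.
[cite: Weil1952FormulesExplicites, (11) pp. 261–262] -/
theorem weilFunctionalChar_add (hk₁ : IsWeilTest k₁) (hk₂ : IsWeilTest k₂) :
    weilFunctionalChar χ (k₁ + k₂) = weilFunctionalChar χ k₁ + weilFunctionalChar χ k₂ := by
  have hM := weilMellin_add hk₁.1.continuous hk₁.2 hk₂.1.continuous hk₂.2
  have hP : weilPolarTerm (k₁ + k₂) = weilPolarTerm k₁ + weilPolarTerm k₂ := by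
    simp only [weilPolarTerm, hM]
    ring
  have hPr : weilPrimeTermChar χ (k₁ + k₂) = weilPrimeTermChar χ k₁ + weilPrimeTermChar χ k₂ := by
    simp only [weilPrimeTermChar]
    rw [← (summable_weilPrimeTermChar χ hk₁.2).tsum_add (summable_weilPrimeTermChar χ hk₂.2)]
    congr 1 with n
    simp only [Pi.add_apply]
    ring
  have hAI : weilArchIntegralChar (charParity χ) (k₁ + k₂) =
      weilArchIntegralChar (charParity χ) k₁ + weilArchIntegralChar (charParity χ) k₂ := by
    simp only [weilArchIntegralChar]
    rw [← integral_add (integrable_archChar_of_isWeilTest hk₁ _) (integrable_archChar_of_isWeilTest hk₂ _)]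
    congr 1 with t
    rw [hM]
    ring
  have hA : weilArchTermChar q (charParity χ) (k₁ + k₂) =
      weilArchTermChar q (charParity χ) k₁ + weilArchTermChar q (charParity χ) k₂ := by
    simp only [weilArchTermChar, hAI, Pi.add_apply]
    ring
  simp only [weilFunctionalChar, hPr, hA]
  split_ifs
  · rw [hP]; ring
  · ring

/-! ## `conj W_χ(k) = W_χ(k̃)` and `Re W_χ(k̃) = Re W_χ(k)` -/

/-- **Conjugation and the involution**: `conj W_χ(k) = W_χ(k̃)` for every `k : ℝ → ℂ` and every `χ`
(the prime summand `χ(n)k(log n) + χ̄(n)k(−log n)` of `k̃` is the conjugate of that of `k`; the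
archimedean weight is real and even; no hypotheses). [cite: Weil1952FormulesExplicites, the «lemme» p. 262] -/
theorem conj_weilFunctionalChar (k : ℝ → ℂ) :
    conj (weilFunctionalChar χ k) = weilFunctionalChar χ (weilReflect k) := by
  have hM : ∀ s, weilMellin (weilReflect k) s = conj (weilMellin k (1 - conj s)) :=
    weilMellin_weilReflect_holds k
  have hhalf : ∀ t : ℝ, (1 : ℂ) - conj (1 / 2 + (t : ℂ) * I) = 1 / 2 + (t : ℂ) * I := fun t ↦ by
    apply Complex.ext <;> (simp; try norm_num)
  have hP : conj (weilPolarTerm k) = weilPolarTerm (weilReflect k) := by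
    rw [weilPolarTerm, weilPolarTerm, map_add, hM, hM, map_one, map_zero, sub_zero, sub_self, add_comm]
  have hΛ : conj (weilPrimeTermChar χ k) = weilPrimeTermChar χ (weilReflect k) := by
    rw [weilPrimeTermChar, weilPrimeTermChar, Complex.conj_tsum]
    refine tsum_congr fun n ↦ ?_
    simp only [weilReflect, neg_neg, map_mul, map_div₀, Complex.conj_ofReal, map_add, Complex.conj_conj]
    ring
  have hA : conj (weilArchTermChar q (charParity χ) k) =
      weilArchTermChar q (charParity χ) (weilReflect k) := by
    have h0 : weilReflect k 0 = conj (k 0) := by simp [weilReflect]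
    rw [weilArchTermChar, weilArchTermChar, map_add, map_mul, map_mul, Complex.conj_ofReal,
      weilArchIntegralChar, weilArchIntegralChar, ← integral_conj, h0]
    congr 2
    · rw [map_div₀, map_one, map_mul, map_ofNat, Complex.conj_ofReal]
    · refine integral_congr_ae (Eventually.of_forall fun t ↦ ?_)
      dsimp only
      rw [map_mul, Complex.conj_ofReal, hM, hhalf t]
  rw [weilFunctionalChar, weilFunctionalChar, map_add, map_sub, hΛ, hA]
  congr 2
  split_ifs
  · exact hP
  · exact map_zero _

/-- `Re W_χ(k̃) = Re W_χ(k)`. [cite: Weil1952FormulesExplicites, the «lemme» p. 262] -/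
theorem re_weilFunctionalChar_weilReflect (k : ℝ → ℂ) :
    (weilFunctionalChar χ (weilReflect k)).re = (weilFunctionalChar χ k).re := by
  rw [← conj_weilFunctionalChar, Complex.conj_re]

/-! ## From squares to the cone of nonnegative transforms -/

/-- **Nonnegativity of `W_χ` on the cone of nonnegative transforms**, from Weil positivity for `χ` and a
factorisation of positive definite tests (hermitian symmetrisation `k_H = (k + k̃)/2`, whose transform on
the line is `Re k̂` and whose value `Re W_χ(k_H)` is `Re W_χ(k)`). [cite: Krein1940] -/
theorem re_weilFunctionalChar_nonneg_of_factor {R a : ℝ} (hpos : WeilPositivityOnChar χ a)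
    (hfac : ∀ k : ℝ → ℂ, IsWeilTest k → tsupport k ⊆ Icc (-R) R →
      (∀ t : ℝ, 0 ≤ (weilMellin k (1 / 2 + t * I)).re ∧ (weilMellin k (1 / 2 + t * I)).im = 0) →
      ∃ φ : ℝ → ℂ, IsWeilTest φ ∧ tsupport φ ⊆ Icc (-a) a ∧ weilConv φ (weilReflect φ) = k)
    {k : ℝ → ℂ} (hk : IsWeilTest k) (hks : tsupport k ⊆ Icc (-R) R)
    (hre : ∀ t : ℝ, 0 ≤ (weilMellin k (1 / 2 + t * I)).re) : 0 ≤ (weilFunctionalChar χ k).re := by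
  set kH : ℝ → ℂ := fun t ↦ (1 / 2 : ℂ) * (k + weilReflect k) t with hkH
  have hkr : IsWeilTest (weilReflect k) := hk.weilReflect
  have hkH_test : IsWeilTest kH := (hk.add hkr).const_mul _
  have hkH_supp : tsupport kH ⊆ Icc (-R) R := by
    refine tsupport_mul_subset_right.trans ((tsupport_add k (weilReflect k)).trans (union_subset hks ?_))
    rw [tsupport_weilReflect]
    intro x hx
    have := hks hx
    simp only [mem_Icc] at this ⊢
    constructor <;> linarith [this.1, this.2]
  have hkH_mellin : ∀ t : ℝ, weilMellin kH (1 / 2 + t * I) = ((weilMellin k (1 / 2 + t * I)).re : ℂ) := by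
    intro t
    rw [hkH, weilMellin_const_mul, weilMellin_add hk.1.continuous hk.2 hkr.1.continuous hkr.2,
      WeilBochner.weilMellin_weilReflect_half, Complex.add_conj]
    push_cast
    ring
  obtain ⟨φ, hφ, hφs, hφk⟩ := hfac kH hkH_test hkH_supp fun t ↦ by
    rw [hkH_mellin t]
    exact ⟨by simpa using hre t, by simp⟩
  have hQ : 0 ≤ (weilFunctionalChar χ kH).re := by
    have := hpos φ hφ hφs
    rwa [weilQuadraticChar, hφk] at this
  have hW : (weilFunctionalChar χ kH).re = (weilFunctionalChar χ k).re := by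
    rw [hkH, weilFunctionalChar_const_mul, weilFunctionalChar_add χ hk hkr, Complex.mul_re, add_re,
      add_im, re_weilFunctionalChar_weilReflect]
    norm_num
    ring
  rwa [hW] at hQ

/-! ## M. Riesz extension -/

/-- **Kreĭn–M. Riesz extension for `W_χ` on a window.**  Let `R > 0` and suppose `Re W_χ(k) ≥ 0` for
every test `k` supported in `[-R, R]` whose transform has `Re k̂(½+it) ≥ 0` for all real `t`.  Then
there is a POSITIVE linear functional `Λ` on `C_c(ℝ, ℝ)` such that `Re W_χ(k) + Λ c ≥ 0` whenever
`k` is a test supported in `[-R, R]`, `c ∈ C_c(ℝ, ℝ)` and `Re k̂(½+it) + c(t) ≥ 0` for all `t`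
(M. Riesz's extension theorem; the domain is cofinal by `WeilBochner.exists_sq_dominating`).
[cite: Krein1940] -/
theorem exists_positive_extension_char {R : ℝ} (hR : 0 < R)
    (hN : ∀ k : ℝ → ℂ, IsWeilTest k → tsupport k ⊆ Icc (-R) R →
      (∀ t : ℝ, 0 ≤ (weilMellin k (1 / 2 + t * I)).re) → 0 ≤ (weilFunctionalChar χ k).re) :
    ∃ Λ : C_c(ℝ, ℝ) →ₚ[ℝ] ℝ, ∀ k : ℝ → ℂ, IsWeilTest k → tsupport k ⊆ Icc (-R) R →
      ∀ c : C_c(ℝ, ℝ), (∀ t : ℝ, 0 ≤ (weilMellin k (1 / 2 + t * I)).re + c t) →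
        0 ≤ (weilFunctionalChar χ k).re + Λ c := by
  classical
  -- adapted from `WeilBochner.exists_positive_extension` (tree, `WeilBochnerExtension.lean`)
  let K : Submodule ℝ (ℝ → ℂ) :=
    { carrier := {k | IsWeilTest k ∧ tsupport k ⊆ Icc (-R) R}
      add_mem' := fun {k₁ k₂} hk₁ hk₂ ↦
        ⟨hk₁.1.add hk₂.1, (tsupport_add k₁ k₂).trans (union_subset hk₁.2 hk₂.2)⟩
      zero_mem' := ⟨⟨contDiff_const, HasCompactSupport.zero⟩, by simp⟩
      smul_mem' := fun c k hk ↦ ⟨WeilBochner.isWeilTest_smul_real hk.1 c,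
        (WeilBochner.tsupport_smul_real_subset c k).trans hk.2⟩ }
  have hKmem : ∀ {k : ℝ → ℂ}, k ∈ K ↔ IsWeilTest k ∧ tsupport k ⊆ Icc (-R) R := Iff.rfl
  let Φ : K →ₗ[ℝ] (ℝ → ℝ) :=
    { toFun := fun k t ↦ (weilMellin (k : ℝ → ℂ) (1 / 2 + t * I)).re
      map_add' := fun k₁ k₂ ↦ by
        funext t
        have h₁ := (hKmem.1 k₁.2).1
        have h₂ := (hKmem.1 k₂.2).1
        simp only [Submodule.coe_add, Pi.add_apply]
        rw [weilMellin_add h₁.1.continuous h₁.2 h₂.1.continuous h₂.2, add_re]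
      map_smul' := fun c k ↦ by
        funext t
        simp only [Submodule.coe_smul, Pi.smul_apply, RingHom.id_apply, smul_eq_mul]
        rw [WeilBochner.weilMellin_smul_real, Complex.re_ofReal_mul] }
  let W : K →ₗ[ℝ] ℝ :=
    { toFun := fun k ↦ (weilFunctionalChar χ (k : ℝ → ℂ)).re
      map_add' := fun k₁ k₂ ↦ by
        have h₁ := (hKmem.1 k₁.2).1
        have h₂ := (hKmem.1 k₂.2).1
        simp only [Submodule.coe_add]
        rw [weilFunctionalChar_add χ h₁ h₂, add_re]
      map_smul' := fun c k ↦ by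
        simp only [Submodule.coe_smul, RingHom.id_apply, smul_eq_mul]
        rw [weilFunctionalChar_smul_real, Complex.re_ofReal_mul] }
  let coeL : C_c(ℝ, ℝ) →ₗ[ℝ] (ℝ → ℝ) :=
    { toFun := fun f ↦ (f : ℝ → ℝ)
      map_add' := fun f g ↦ CompactlySupportedContinuousMap.coe_add f g
      map_smul' := fun c f ↦ CompactlySupportedContinuousMap.coe_smul c f }
  let ev : (K × C_c(ℝ, ℝ)) →ₗ[ℝ] (ℝ → ℝ) := Φ.coprod coeL
  let s : PointedCone ℝ (K × C_c(ℝ, ℝ)) := (PointedCone.positive ℝ (ℝ → ℝ)).comap ev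
  have hs : ∀ x : K × C_c(ℝ, ℝ),
      x ∈ s ↔ ∀ t : ℝ, 0 ≤ (weilMellin (x.1 : ℝ → ℂ) (1 / 2 + t * I)).re + x.2 t := fun x ↦ Iff.rfl
  let D : Submodule ℝ (K × C_c(ℝ, ℝ)) := Submodule.prod ⊤ ⊥
  let fP : (K × C_c(ℝ, ℝ)) →ₗ.[ℝ] ℝ := ⟨D, W.comp ((LinearMap.fst ℝ K (C_c(ℝ, ℝ))).comp D.subtype)⟩
  have hfP : ∀ x : fP.domain, fP x = (weilFunctionalChar χ ((x : K × C_c(ℝ, ℝ)).1 : ℝ → ℂ)).re :=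
    fun x ↦ rfl
  have hnonneg : ∀ x : fP.domain, (x : K × C_c(ℝ, ℝ)) ∈ s → 0 ≤ fP x := by
    intro x hx
    have hx2 : ((x : K × C_c(ℝ, ℝ))).2 = 0 := (Submodule.mem_bot ℝ).1 (Submodule.mem_prod.1 x.2).2
    have hk := hKmem.1 ((x : K × C_c(ℝ, ℝ))).1.2
    rw [hfP]
    refine hN _ hk.1 hk.2 fun t ↦ ?_
    have := (hs _).1 hx t
    simpa [hx2] using this
  have hdense : ∀ y : K × C_c(ℝ, ℝ), ∃ x : fP.domain, (x : K × C_c(ℝ, ℝ)) + y ∈ s := by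
    rintro ⟨k₁, c⟩
    obtain ⟨k₀, hk₀, hk₀s, -, M, hM⟩ := WeilBochner.exists_sq_dominating hR c
    set k₀K : K := ⟨k₀, hKmem.2 ⟨hk₀, hk₀s⟩⟩ with hk₀K
    have hxD : ((M • k₀K - k₁, (0 : C_c(ℝ, ℝ))) : K × C_c(ℝ, ℝ)) ∈ D :=
      Submodule.mem_prod.2 ⟨Submodule.mem_top, Submodule.zero_mem _⟩
    refine ⟨⟨(M • k₀K - k₁, 0), hxD⟩, ?_⟩
    show ((M • k₀K - k₁, (0 : C_c(ℝ, ℝ))) : K × C_c(ℝ, ℝ)) + (k₁, c) ∈ s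
    rw [Prod.mk_add_mk, sub_add_cancel, zero_add]
    refine (hs _).2 fun t ↦ ?_
    simp only [Submodule.coe_smul]
    rw [WeilBochner.weilMellin_smul_real, Complex.re_ofReal_mul]
    exact hM t
  obtain ⟨G, hGf, hGs⟩ := riesz_extension s fP hnonneg hdense
  let Λl : C_c(ℝ, ℝ) →ₗ[ℝ] ℝ := G.comp (LinearMap.inr ℝ K (C_c(ℝ, ℝ)))
  have hΛl : ∀ c, Λl c = G (0, c) := fun c ↦ rfl
  have hΛpos : ∀ c : C_c(ℝ, ℝ), 0 ≤ c → 0 ≤ Λl c := by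
    intro c hc
    rw [hΛl]
    refine hGs _ ((hs _).2 fun t ↦ ?_)
    have hct : 0 ≤ c t := by
      have := (CompactlySupportedContinuousMap.le_def.1 hc) t
      simpa using this
    simpa [weilMellin] using hct
  refine ⟨PositiveLinearMap.mk₀ Λl hΛpos, fun k hk hks c hc ↦ ?_⟩
  set kK : K := ⟨k, hKmem.2 ⟨hk, hks⟩⟩ with hkK
  have hmem : ((kK, c) : K × C_c(ℝ, ℝ)) ∈ s := (hs _).2 hc
  have h0 := hGs _ hmem
  have hsplit : G (kK, c) = G (kK, 0) + G (0, c) := by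
    rw [← map_add, Prod.mk_add_mk, add_zero, zero_add]
  have hx₀ : ((kK, (0 : C_c(ℝ, ℝ))) : K × C_c(ℝ, ℝ)) ∈ D :=
    Submodule.mem_prod.2 ⟨Submodule.mem_top, Submodule.zero_mem _⟩
  have hW : G (kK, 0) = (weilFunctionalChar χ k).re := by rw [hGf ⟨(kK, 0), hx₀⟩, hfP]
  have hΛ : (PositiveLinearMap.mk₀ Λl hΛpos) c = G (0, c) := rfl
  linarith [h0, hsplit, hW, hΛ]

end WeilBochnerChar

end Literature.NumberTheory.LFunctions

end
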